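import Literature.Computation.Certificates.KeyedGramStreamPasses

/-!
# Gram entry streams, III: the twin bound and the packed-rows bridge

Companion of `KeyedGramStream` / `KeyedGramStreamPasses` in the «K-STREAM» kernel lane. Proved
here: the pair-indexed Gram sum is the quadratic form of the stream's symmetric matrix `Qz` at the
monomial vector (`sum_pairs_eq_quadForm`, with the carry-free product lemma `monoEval_add` for
`x^{key i + key j} = x^{key i}·x^{key j}`); the side pass's `closeN` entries are exactly the
entrywise closeness `|S·Q_ij − L·(M_ij + s₂[i=j])| ≤ L·e` to the twin (`closeN_spec`,
`close_of_passes`); hence, by the rounded-twin perturbation lemma `PSD.quadForm_nonneg_of_near`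
(with `A = S·Qz`, `C = L·(M + s₂I)`, `δ = L·s₂`, `ε = L·e`), the Gram part of the stream is
nonnegative at every point (`gsum_nonneg`); the twin read by two-level access IS the matrix of the
packed rows PSD lane on the flattened row list (`getD2_eq_getD_flatten`, `Mz_eq_intMatrixRows`),
which gives `gsum_nonneg_of_isGramCertZ` with every remaining side condition a decidable Boolean
(`keysOK`, `groupsOK`). [cite: BlekhermanParriloThomas2012, Thm 3.39, p. 65];
[cite: Rump1999VerifiedLargeSystems, §4 Algorithm 4.1 step 7]; [cite: Harvey2009, §3.1].

WHAT THIS FILE IS NOT: not a PSD test of `Q` itself (PSD comes from the twin plus closeness); the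
table part of a stream is given meaning by the product-stream companion (to come).
-/

namespace Literature.Computation.Certificates

namespace SOS

namespace Keyed

open PSD


/-! ### Symmetrisation and the twin bound -/

section Twin

section Symm

variable {R : Type*} [Field R]

/-- **Pairs ↔ quadratic form**: `Σ_{i≤j} mult(i,j)·V_ij·y_i y_j = Σ_i Σ_j y_i W_ij y_j` with the
symmetrised `W_ij = V_{min,max}`. [cite: BlekhermanParriloThomas2012, §3.1.4 eq. (3.12), p. 64] -/
theorem sum_pairs_eq_quadForm (s : ℕ) (V : ℕ → ℕ → R) (y : ℕ → R) :
    ∑ q ∈ upperPairs s, (mult q.1 q.2 : R) * V q.1 q.2 * (y q.1 * y q.2) =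
      ∑ i ∈ Finset.range s, ∑ j ∈ Finset.range s, y i * (if i ≤ j then V i j else V j i) * y j := by
  -- right-hand side: split each summand into its upper (`i ≤ j`) and strictly lower (`j < i`) part
  have hsplit : ∀ i j, y i * (if i ≤ j then V i j else V j i) * y j =
      (if i ≤ j then y i * V i j * y j else 0) + (if j < i then y i * V j i * y j else 0) := by
    intro i j
    by_cases h : i ≤ j
    · rw [if_pos h, if_pos h, if_neg (not_lt.mpr h), add_zero]
    · rw [if_neg h, if_neg h, if_pos (lt_of_not_ge h), zero_add]
  simp_rw [hsplit, Finset.sum_add_distrib]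
  -- the lower part, after exchanging the summations, is the strict upper part
  have hlow : ∑ i ∈ Finset.range s, ∑ j ∈ Finset.range s, (if j < i then y i * V j i * y j else 0) =
      ∑ i ∈ Finset.range s, ∑ j ∈ Finset.range s, (if i < j then y i * V i j * y j else 0) := by
    rw [Finset.sum_comm]
    refine Finset.sum_congr rfl fun i _ => Finset.sum_congr rfl fun j _ => ?_
    by_cases h : i < j
    · rw [if_pos h, if_pos h]; ring
    · rw [if_neg h, if_neg h]
  rw [hlow, ← Finset.sum_add_distrib]
  simp_rw [← Finset.sum_add_distrib]
  -- left-hand side as a double sum with an indicator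
  rw [upperPairs, Finset.sum_filter, Finset.sum_product]
  refine Finset.sum_congr rfl fun i _ => Finset.sum_congr rfl fun j _ => ?_
  by_cases h : i ≤ j
  · by_cases h' : i < j
    · have hm : mult i j = 2 := by unfold mult; rw [if_neg (Nat.ne_of_lt h')]
      rw [if_pos h, if_pos h, if_pos h', hm]; push_cast; ring
    · have hij : i = j := le_antisymm h (not_lt.mp h')
      subst hij
      have hm : mult i i = 1 := by unfold mult; rw [if_pos rfl]
      rw [if_pos h, if_pos h, if_neg h', hm]; push_cast; ring
  · rw [if_neg h, if_neg h, if_neg (fun h' => h (le_of_lt h')), add_zero]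

end Symm

/-- Membership in `upperPairs` (local copy; the `Passes` file keeps its own private). [folklore] -/
private theorem mem_upperPairs' {s : ℕ} {q : ℕ × ℕ} : q ∈ upperPairs s ↔ q.1 ≤ q.2 ∧ q.2 < s := by
  unfold upperPairs
  simp only [Finset.mem_filter, Finset.mem_product, Finset.mem_range]
  constructor
  · rintro ⟨⟨_, h2⟩, h3⟩; exact ⟨h3, h2⟩
  · rintro ⟨h1, h2⟩; exact ⟨⟨by omega, h2⟩, h1⟩

/-- **Specification of `closeN`**: `|S·(±a) − L·(dg − off + s₂·[diag])| ≤ L·e` over `ℤ`.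
[cite: Rump1999VerifiedLargeSystems, §4 Algorithm 4.1 step 7] -/
theorem closeN_spec {S L s₂ e off a dg : ℕ} {diag sg : Bool}
    (h : closeN S L s₂ e off diag sg a dg = true) :
    |(S : ℤ) * sval sg a - (L : ℤ) * ((dg : ℤ) - (off : ℤ) + if diag then (s₂ : ℤ) else 0)| ≤ (L : ℤ) * e := by
  unfold closeN at h
  set P := (if sg then S * a else 0) + L * off with hP
  set N := (if sg then 0 else S * a) + L * (dg + if diag then s₂ else 0) with hN
  have hPN : (S : ℤ) * sval sg a - (L : ℤ) * ((dg : ℤ) - (off : ℤ) + if diag then (s₂ : ℤ) else 0) =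
      (P : ℤ) - (N : ℤ) := by
    rw [hP, hN]; unfold sval
    cases sg <;> cases diag <;> simp <;> ring
  rw [hPN]
  by_cases hle : N ≤ P
  · rw [if_pos hle, decide_eq_true_eq] at h
    rw [abs_of_nonneg (by omega)]
    have : ((P - N : ℕ) : ℤ) ≤ ((L * e : ℕ) : ℤ) := by exact_mod_cast h
    push_cast [Nat.cast_sub hle] at this
    linarith
  · rw [if_neg hle, decide_eq_true_eq] at h
    rw [abs_of_neg (by omega)]
    have : ((N - P : ℕ) : ℤ) ≤ ((L * e : ℕ) : ℤ) := by exact_mod_cast h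
    push_cast [Nat.cast_sub (le_of_not_ge hle)] at this
    linarith

/-- The twin matrix read through the side pass's accessor: `M_ij = mAt i j − 2^(wm−1)`.
[cite: Harvey2009, §3.1] -/
def Mz (c : GramCtx) (d : SideCtx) : Matrix (Fin c.s) (Fin c.s) ℤ :=
  fun i j => (d.mAt i.val j.val : ℤ) - ((2 ^ (d.wm - 1) : ℕ) : ℤ)

/-- **Entrywise closeness of the stream's matrix to the twin**, from the side conditions and the
pair pass: `|S·Q_ij − L·(M_ij + s₂·[i=j])| ≤ L·e` for all `i, j`.
[cite: Rump1999VerifiedLargeSystems, §4 Algorithm 4.1 step 7] -/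
theorem close_of_passes {c : GramCtx} {d : SideCtx} {EL : List Entry} (hside : SideAll c d EL)
    (hpair : pairPass c d EL.length = true) (i j : Fin c.s) :
    |(d.S : ℤ) * Qz c d EL i j - (d.L : ℤ) * (Mz c d i j + if i = j then (d.s₂ : ℤ) else 0)| ≤
      (d.L : ℤ) * d.e := by
  unfold Qz Mz
  by_cases hij : i.val ≤ j.val
  · obtain ⟨sg, mag, hE, hs⟩ := entryAt_posAt hside hpair hij j.isLt
    simp only [sideEntry, Bool.and_eq_true, decide_eq_true_eq, beq_iff_eq] at hs
    obtain ⟨⟨_, hc1⟩, _⟩ := hs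
    have h1 := closeN_spec hc1
    rw [if_pos hij, valAt, hE]
    by_cases he : i = j
    · subst he
      rw [if_pos rfl]
      simpa using h1
    · have hdiag : (i.val == j.val) = false := beq_eq_false_iff_ne.mpr (Fin.val_ne_of_ne he)
      rw [hdiag] at h1
      rw [if_neg he]
      simpa using h1
  · have hji : j.val ≤ i.val := by omega
    have hne : i ≠ j := fun h => hij (h ▸ le_refl _)
    obtain ⟨sg, mag, hE, hs⟩ := entryAt_posAt hside hpair hji i.isLt
    simp only [sideEntry, Bool.and_eq_true, decide_eq_true_eq, beq_iff_eq] at hs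
    obtain ⟨_, hc2⟩ := hs
    have h2 := closeN_spec hc2
    rw [if_neg hij, valAt, hE, if_neg hne]
    have hdiag : (j.val == i.val) = false := by
      rw [beq_eq_false_iff_ne]; exact fun h => hne (Fin.ext h.symm)
    rw [hdiag] at h2
    simpa using h2

section Main

variable {R : Type*} [Field R] [LinearOrder R] [IsStrictOrderedRing R]

/-- **The Gram part of the stream is a nonnegative quadratic form.** From: side conditions at all
positions, the pair pass, digit bounds of the basis keys (so that `x^{key i + key j} =
x^{key i}·x^{key j}`), nonnegativity of the TWIN's quadratic form (any PSD lane, e.g.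
`PSD.IsGramCertZ.quadForm_nonneg` on the packed rows), the margin `s·e ≤ s₂` and `0 < S` —
conclude `0 ≤ Σ (Gram terms)(x)` at every point, via `PSD.quadForm_nonneg_of_near`.
[cite: BlekhermanParriloThomas2012, Thm 3.39, p. 65; Rump1999VerifiedLargeSystems, §4 Algorithm 4.1 step 7] -/
theorem gsum_nonneg (x : ℕ → R) {b n D : ℕ} {c : GramCtx} {d : SideCtx} {EL : List Entry}
    (hside : SideAll c d EL) (hpair : pairPass c d EL.length = true)
    (hkeys : ∀ a < c.s, digitsLe b D n (c.key a) = true) (hD : D + D < b)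
    (hM : ∀ z : Fin c.s → R, 0 ≤ ∑ i, ∑ j, z i * (Mz c d i j : R) * z j)
    (hmargin : c.s * d.e ≤ d.s₂) (hS : 0 < d.S) :
    0 ≤ gsum x b n c EL := by
  -- (1) the Gram sum as the quadratic form of `Qz` at the monomial vector
  let y : ℕ → R := fun a => monoEval x b n 0 (c.key a)
  have hform : gsum x b n c EL = ∑ i : Fin c.s, ∑ j : Fin c.s, y i.val * (Qz c d EL i j : R) * y j.val := by
    rw [gsum_eq_sum_pairs x b n hside hpair]
    have h1 : ∑ q ∈ upperPairs c.s, (((mult q.1 q.2 : ℤ) * valAt EL (d.posAt q.1 q.2) : ℤ) : R) *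
        monoEval x b n 0 (c.key q.1 + c.key q.2) =
        ∑ q ∈ upperPairs c.s, (mult q.1 q.2 : R) * (valAt EL (d.posAt q.1 q.2) : R) * (y q.1 * y q.2) := by
      refine Finset.sum_congr rfl fun q hq => ?_
      rw [mem_upperPairs'] at hq
      rw [monoEval_add x hD n 0 _ _ (hkeys q.1 (by omega)) (hkeys q.2 hq.2)]
      push_cast; ring
    rw [h1, sum_pairs_eq_quadForm c.s (fun i j => (valAt EL (d.posAt i j) : R)) y,
      ← Fin.sum_univ_eq_sum_range]
    refine Finset.sum_congr rfl fun i _ => ?_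
    rw [← Fin.sum_univ_eq_sum_range]
    refine Finset.sum_congr rfl fun j _ => ?_
    unfold Qz
    split <;> rfl
  rw [hform]
  -- (2) the twin perturbation lemma with A = S·Qz, C = L·(M + s₂ I), δ = L·s₂, ε = L·e
  have hL : (0 : R) ≤ (d.L : R) := Nat.cast_nonneg _
  have hnear := PSD.quadForm_nonneg_of_near
    (fun i j => (d.S : R) * (Qz c d EL i j : R))
    (fun i j => (d.L : R) * ((Mz c d i j : R) + if i = j then (d.s₂ : R) else 0))
    (δ := (d.L : R) * d.s₂) (ε := (d.L : R) * d.e) ?_ ?_ ?_ (fun i => y i.val)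
  · -- 0 ≤ yᵀ (S Qz) y = S · yᵀ Qz y
    have hSQ : ∑ i : Fin c.s, ∑ j : Fin c.s, y i.val * ((d.S : R) * (Qz c d EL i j : R)) * y j.val =
        (d.S : R) * ∑ i : Fin c.s, ∑ j : Fin c.s, y i.val * (Qz c d EL i j : R) * y j.val := by
      rw [Finset.mul_sum]
      refine Finset.sum_congr rfl fun i _ => ?_
      rw [Finset.mul_sum]
      refine Finset.sum_congr rfl fun j _ => ?_
      ring
    rw [hSQ] at hnear
    have hS' : (0 : R) < (d.S : R) := by exact_mod_cast hS
    nlinarith [hnear, hS']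
  · -- hC : L s₂ ‖z‖² ≤ zᵀ C z
    intro z
    have hMz := hM z
    have hinner : ∀ i : Fin c.s,
        ∑ j : Fin c.s, z i * ((d.L : R) * ((Mz c d i j : R) + if i = j then (d.s₂ : R) else 0)) * z j =
          (d.L : R) * ∑ j, z i * (Mz c d i j : R) * z j + (d.L : R) * d.s₂ * z i ^ 2 := by
      intro i
      have hpt : ∀ j : Fin c.s, z i * ((d.L : R) * ((Mz c d i j : R) + if i = j then (d.s₂ : R) else 0)) * z j =
          (d.L : R) * (z i * (Mz c d i j : R) * z j) + (if i = j then (d.L : R) * d.s₂ * (z i * z j) else 0) := by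
        intro j; split <;> ring
      simp_rw [hpt, Finset.sum_add_distrib, Finset.sum_ite_eq, Finset.mem_univ, if_true, ← Finset.mul_sum]
      ring
    have hexp : ∑ i : Fin c.s, ∑ j : Fin c.s, z i * ((d.L : R) * ((Mz c d i j : R) + if i = j then (d.s₂ : R) else 0)) * z j =
        (d.L : R) * (∑ i, ∑ j, z i * (Mz c d i j : R) * z j) + (d.L : R) * d.s₂ * ∑ i, z i ^ 2 := by
      simp_rw [hinner, Finset.sum_add_distrib, ← Finset.mul_sum]
    rw [hexp]
    nlinarith [mul_nonneg hL hMz]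
  · -- hE
    intro i j
    have h := close_of_passes hside hpair i j
    have h' : |((d.S : ℤ) * Qz c d EL i j - (d.L : ℤ) * (Mz c d i j + if i = j then (d.s₂ : ℤ) else 0) : ℤ)| ≤
        (((d.L : ℤ) * d.e : ℤ)) := h
    have := (Int.cast_le (R := R)).mpr h'
    rw [Int.cast_abs] at this
    push_cast at this
    simpa using this
  · -- hδ : s · (L e) ≤ L s₂
    have : (c.s : R) * (d.e : R) ≤ (d.s₂ : R) := by exact_mod_cast hmargin
    nlinarith

end Main

end Twin

/-! ### Checkable side conditions, the packed-rows bridge, window glue -/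

section Glue

/-- **Key digit bounds** of the whole basis as one Boolean (`decide` on the key table).
[cite: Harvey2009, §3.1] -/
def keysOK (c : GramCtx) (b D n : ℕ) : Bool :=
  (List.range c.s).all fun a => digitsLe b D n (c.key a)

/-- `keysOK` gives the digit bound of every basis key. [cite: Harvey2009, §3.1] -/
theorem digitsLe_of_keysOK {c : GramCtx} {b D n : ℕ} (h : keysOK c b D n = true) :
    ∀ a < c.s, digitsLe b D n (c.key a) = true := by
  intro a ha
  simp only [keysOK, List.all_eq_true, List.mem_range] at h
  exact h a ha

/-- **Group shape**: every group but the last has exactly `R` rows, the last at most `R`, and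
`0 < R` — so that `getD2 LL R t` reads entry `t` of `LL.flatten`. [folklore] -/
def groupsOK (R : ℕ) : List (List ℕ) → Bool
  | [] => decide (0 < R)
  | [g] => decide (0 < R) && decide (g.length ≤ R)
  | g :: g' :: rest => (g.length == R) && groupsOK R (g' :: rest)

/-- `groupsOK` forces `0 < R`. [folklore] -/
private theorem pos_of_groupsOK {R : ℕ} : ∀ {LL : List (List ℕ)}, groupsOK R LL = true → 0 < R
  | [], h => by simpa [groupsOK] using h
  | [g], h => by simp [groupsOK] at h; exact h.1
  | g :: g' :: rest, h => by
    simp only [groupsOK, Bool.and_eq_true, beq_iff_eq] at h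
    exact pos_of_groupsOK h.2

/-- **Two-level access reads the flattened table.** [cite: Harvey2009, §3.1] -/
theorem getD2_eq_getD_flatten {R : ℕ} :
    ∀ {LL : List (List ℕ)}, groupsOK R LL = true → ∀ t, getD2 LL R t = LL.flatten.getD t 0
  | [], _, t => by simp [getD2]
  | [g], h, t => by
    simp only [groupsOK, Bool.and_eq_true, decide_eq_true_eq] at h
    obtain ⟨hR, hg⟩ := h
    simp only [getD2, List.flatten_cons, List.flatten_nil, List.append_nil]
    by_cases ht : t < R
    · rw [Nat.div_eq_of_lt ht, Nat.mod_eq_of_lt ht]; rfl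
    · rw [not_lt] at ht
      have h1 : 1 ≤ t / R := (Nat.le_div_iff_mul_le hR).mpr (by simpa using ht)
      obtain ⟨k, hk⟩ := Nat.exists_eq_add_of_le h1
      rw [hk, List.getD_eq_default _ _ (by omega : g.length ≤ t)]
      simp [Nat.add_comm 1 k]
  | g :: g' :: rest, h, t => by
    simp only [groupsOK, Bool.and_eq_true, beq_iff_eq] at h
    obtain ⟨hg, hrest⟩ := h
    have hR : 0 < R := pos_of_groupsOK hrest
    rw [List.flatten_cons]
    by_cases ht : t < R
    · simp only [getD2]
      rw [Nat.div_eq_of_lt ht, Nat.mod_eq_of_lt ht, List.getD_append _ _ _ _ (hg ▸ ht)]; rfl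
    · rw [not_lt] at ht
      obtain ⟨t', rfl⟩ := Nat.exists_eq_add_of_le ht
      rw [List.getD_append_right _ _ _ _ (by omega), hg, Nat.add_sub_cancel_left,
        ← getD2_eq_getD_flatten hrest t']
      simp only [getD2]
      rw [Nat.add_div_left _ hR, Nat.add_mod_left, List.getD_cons_succ]

/-- **The twin read by the side pass is the matrix of the packed rows lane** on the flattened
row list: `Mz = PSD.Packed.intMatrixRows s wm (Mrows.flatten)`. [cite: Harvey2009, §3.1] -/
theorem Mz_eq_intMatrixRows (c : GramCtx) (d : SideCtx) (h : groupsOK d.R d.Mrows = true) :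
    Mz c d = PSD.Packed.intMatrixRows c.s d.wm d.Mrows.flatten := by
  ext i j
  simp only [Mz, SideCtx.mAt, bigDigit, PSD.Packed.intMatrixRows, PSD.Packed.rowEntry,
    getD2_eq_getD_flatten h]

section Ordered

variable {R : Type*} [Field R] [LinearOrder R] [IsStrictOrderedRing R]

/-- **Gram part ≥ 0 with the twin certified by the packed rows PSD lane** (`PSD.Packed.checkRows`
on `Mrows.flatten`, any weights/factor), all other side conditions as decidable Booleans.
[cite: BlekhermanParriloThomas2012, Thm 3.39, p. 65; Rump1999VerifiedLargeSystems, §4 Algorithm 4.1 step 7] -/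
theorem gsum_nonneg_of_isGramCertZ (x : ℕ → R) {b n D : ℕ} {c : GramCtx} {d : SideCtx}
    {EL : List Entry} {m : ℕ} {dd : Fin m → ℕ} {B : Matrix (Fin m) (Fin c.s) ℤ}
    (hside : SideAll c d EL) (hpair : pairPass c d EL.length = true)
    (hkeys : keysOK c b D n = true) (hD : D + D < b) (hgroups : groupsOK d.R d.Mrows = true)
    (hM : PSD.IsGramCertZ (PSD.Packed.intMatrixRows c.s d.wm d.Mrows.flatten) dd B)
    (hmargin : c.s * d.e ≤ d.s₂) (hS : 0 < d.S) :
    0 ≤ gsum x b n c EL := by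
  refine gsum_nonneg x hside hpair (digitsLe_of_keysOK hkeys) hD (fun z => ?_) hmargin hS
  rw [Mz_eq_intMatrixRows c d hgroups]
  exact hM.quadForm_nonneg z

end Ordered

end Glue

end Keyed

end SOS

end Literature.Computation.Certificates
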